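import Mathlib.MeasureTheory.Integral.IntervalIntegral.LebesgueDifferentiationThm
import Mathlib.MeasureTheory.Integral.Prod
import Mathlib.MeasureTheory.Function.UniformIntegrable
import Mathlib.MeasureTheory.Integral.DominatedConvergence
import Mathlib.Topology.Algebra.Order.Group
import Mathlib.MeasureTheory.Measure.Lebesgue.Basic
import Mathlib.MeasureTheory.Group.Measure
import HarnessLib

/-!
# A chain-rule inequality for energies satisfying a restarted integral inequality

Analysis/FluidPDE support file for the discharge of
`Literature.Analysis.FluidPDE.timeAverage_isStationary` (Foias–Manley–Rosa–Temam 2001, Ch. IV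
Thm. 3.1 with App. B.2: time-average measures of a Leray–Hopf solution are stationary
statistical solutions), property (1.31) — the energy inequality on energy shells.

The printed proof (FMRT 2001, App. B.2, (B.29)–(B.36), PDF pp. 259–261) needs the
**generalized energy inequality**

  `ρ(|u(T)|²) − ρ(|u₀|²) ≤ 2 ∫₀ᵀ ρ'(|u(t)|²) [(f, u(t)) − ν ‖u(t)‖²] dt`   (B.33)–(B.36)

for nondecreasing `ρ ∈ C²` with `ρ'` bounded, derived there from the Leray–Hopf energy
inequality (valid from `s = 0` and from a.e. `s > 0`, Ch. II (7.20)) by Riemann sums over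
partitions through the good set `I₀` and a pointwise limit `β_j → 0` using one-sided continuity
of `t ↦ |u(t)|²`.

This file proves the same inequality by a **different, partition-free route (Steklov
averaging)**, in abstract form. Let `y` (the energy) be bounded and measurable on `(0, T]`,
`g ∈ L¹(0, T)` (the energy flux `2[(f,u) − ν‖u‖²]`), and assume the restarted inequality
`y(t) ≤ y(s) + ∫ₛᵗ g` for every `t ≥ s`, for `s = 0` (with `y(0)` read as `E₀`) and for a.e.
`s ∈ (0, T)`. Let `φ ≥ 0` be bounded and Lipschitz (`φ = ρ'`). Then
(`RestartedChainRule.intervalIntegral_le_setIntegral`)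

  `∫_{E₀}^{y(T)} φ ≤ ∫_{(0,T]} φ(y(t)) g(t) dt`.

Proof. With `P = ∫₀ φ` (nondecreasing, `M`-Lipschitz, and
`P(a + G) − P(a) ≤ φ(a) G + L G²`, `primitive_taylor`), for `0 < h < T` and a.e. `s ≤ T − h`
the restarted inequality gives `P(y(s+h)) − P(y(s)) ≤ φ(y(s)) Gₕ(s) + L Gₕ(s)²`,
`Gₕ(s) = ∫ₛ^{s+h} g`. Integrating in `s`: the left side telescopes (translation invariance)
into `∫_{T−h}^T P∘y − ∫₀^h P∘y ≥ h [P(y(T)) − P(E₀)] − 2Mh ω(h)` (the restarted inequality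
once more at both ends, `ω(h) = sup_{|J| ≤ h} ∫_J |g| → 0`, `exists_forall_setIntegral_abs_le`);
on the right, `∫ L Gₕ² ≤ L ω(h) ∫ |Gₕ| ≤ L ω(h) h ‖g‖₁`, and by Fubini
(`window_fubini`) `∫ φ(y(s)) Gₕ(s) ds = ∫ g(τ) (∫_{τ−h}^{τ} φ∘y) dτ`, where
`h⁻¹ ∫_{τ−h}^{τ} φ∘y → φ(y(τ))` for a.e. `τ` by the **Lebesgue differentiation theorem**
(Mathlib's `LocallyIntegrable.ae_hasDerivAt_integral`), boundedly, so dominated convergence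
applies (`tendsto_window_integral`). Divide by `h` and let `h → 0⁺`. No continuity of `y`
is used anywhere.

All statements are real analysis on `ℝ`; the application to Leray–Hopf solutions is made in the
consumer file. No definitions are introduced.

## Mathlib search

Used: `LocallyIntegrable.ae_hasDerivAt_integral` (Lebesgue differentiation, interval form),
`HasDerivAt.tendsto_slope_zero_left`, `tendsto_neg_nhdsGT`, `MemLp.eLpNorm_indicator_le`
(absolute continuity of the integral), `tendsto_integral_filter_of_dominated_convergence`,
`integral_integral_swap` + `Integrable.mul_prod` + `Integrable.integral_prod_right` (Fubini),
`MeasurePreserving.setIntegral_preimage_emb` / `integrableOn_comp_preimage` with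
`measurePreserving_add_right` (translation), `intervalIntegral.norm_integral_le_of_norm_le_const`.
Mathlib has no chain rule for functions satisfying only an integral inequality (searched
`BoundedVariation`, `AbsolutelyContinuousOnInterval`: chain rules there need genuine absolute
continuity, which `t ↦ |u(t)|²` lacks in dimension three).

## References

* C. Foias, O. Manley, R. Rosa, R. Temam, *Navier–Stokes Equations and Turbulence*, Cambridge
  Univ. Press (2001), Ch. II §7 (7.20) (PDF p. 74); App. B.2, (B.29)–(B.36) (PDF pp. 259–261).
  [FMRT2001]
-/

noncomputable section

open MeasureTheory Set Filter Topology
open scoped NNReal ENNReal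

namespace Literature.Analysis.FluidPDE

namespace RestartedChainRule

/-! ### The primitive of a bounded Lipschitz function -/

/-- **First-order Taylor bound for the primitive of a Lipschitz function**:
`∫ₐ^{a+G} φ ≤ φ(a) G + L G²` for `φ` `L`-Lipschitz (any sign of `G`). [folklore] -/
theorem primitive_taylor {φ : ℝ → ℝ} {L : ℝ≥0} (hφ : LipschitzWith L φ) (a G : ℝ) :
    ∫ x in a..a + G, φ x ≤ φ a * G + L * G ^ 2 := by
  have hc : Continuous φ := hφ.continuous
  have h1 : ∫ x in a..a + G, φ x = φ a * G + ∫ x in a..a + G, (φ x - φ a) := by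
    rw [intervalIntegral.integral_sub (hc.intervalIntegrable _ _) intervalIntegrable_const,
      intervalIntegral.integral_const, smul_eq_mul]
    ring
  have h2 : ‖∫ x in a..a + G, (φ x - φ a)‖ ≤ (L * |G|) * |a + G - a| := by
    refine intervalIntegral.norm_integral_le_of_norm_le_const fun x hx => ?_
    rw [Real.norm_eq_abs, ← Real.dist_eq]
    calc dist (φ x) (φ a) ≤ L * dist x a := hφ.dist_le_mul x a
      _ ≤ L * |G| := by
        gcongr
        rw [Real.dist_eq]
        have := abs_sub_left_of_mem_uIcc (uIoc_subset_uIcc hx)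
        rwa [add_sub_cancel_left] at this
  rw [add_sub_cancel_left, Real.norm_eq_abs] at h2
  have h3 : ∫ x in a..a + G, (φ x - φ a) ≤ L * G ^ 2 :=
    calc ∫ x in a..a + G, (φ x - φ a) ≤ |∫ x in a..a + G, (φ x - φ a)| := le_abs_self _
      _ ≤ L * |G| * |G| := h2
      _ = L * G ^ 2 := by rw [mul_assoc, abs_mul_abs_self, sq]
  rw [h1]
  linarith

/-! ### Absolute continuity of the integral, uniformly over short intervals -/

/-- For `g ∈ L¹(0, T)` and `ε > 0` there is `δ > 0` with `∫_{(a,b]} |g| ≤ ε` for every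
subinterval of `[0, T]` of length `b - a ≤ δ` (absolute continuity of the Lebesgue integral,
Mathlib's `MemLp.eLpNorm_indicator_le`). [folklore] -/
theorem exists_forall_setIntegral_abs_le {g : ℝ → ℝ} {T : ℝ} (hg : IntegrableOn g (Ioc 0 T))
    {ε : ℝ} (hε : 0 < ε) :
    ∃ δ : ℝ, 0 < δ ∧ ∀ a b, 0 ≤ a → b ≤ T → b - a ≤ δ → ∫ τ in Ioc a b, |g τ| ≤ ε := by
  have hmem : MemLp g 1 (volume.restrict (Ioc 0 T)) := memLp_one_iff_integrable.2 hg
  obtain ⟨δ, hδ, H⟩ := hmem.eLpNorm_indicator_le le_rfl ENNReal.one_ne_top hε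
  refine ⟨δ, hδ, fun a b ha hb hab => ?_⟩
  have hsub : Ioc a b ⊆ Ioc 0 T := Ioc_subset_Ioc ha hb
  have hμ : volume.restrict (Ioc 0 T) (Ioc a b) ≤ ENNReal.ofReal δ := by
    rw [Measure.restrict_apply measurableSet_Ioc, inter_eq_left.2 hsub, Real.volume_Ioc]
    exact ENNReal.ofReal_le_ofReal hab
  have h1 := H (Ioc a b) measurableSet_Ioc hμ
  rw [eLpNorm_indicator_eq_eLpNorm_restrict measurableSet_Ioc,
    Measure.restrict_restrict measurableSet_Ioc, inter_eq_left.2 hsub,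
    eLpNorm_one_eq_lintegral_enorm] at h1
  have h2 : ∫ τ in Ioc a b, |g τ| = (∫⁻ τ in Ioc a b, ‖g τ‖ₑ).toReal := by
    rw [← integral_norm_eq_lintegral_enorm (hg.mono_set hsub).aestronglyMeasurable]
    rfl
  rw [h2]
  exact ENNReal.toReal_le_of_le_ofReal hε.le h1

/-! ### The window Fubini identity -/

/-- The window `{(s, τ) | s < τ ≤ s + h}` is a measurable subset of `ℝ × ℝ`. [folklore] -/
theorem measurableSet_window (h : ℝ) :
    MeasurableSet {p : ℝ × ℝ | p.1 < p.2 ∧ p.2 ≤ p.1 + h} :=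
  (measurableSet_lt measurable_fst measurable_snd).inter
    (measurableSet_le measurable_snd (measurable_fst.add_const h))

/-- **Window Fubini.** For `φ` bounded measurable and `g` integrable on `(0, T]`, `0 < h ≤ T`:
`∫₀^{T−h} φ(s) (∫ₛ^{s+h} g) ds = ∫₀ᵀ g(τ) (∫_{(0,T−h] ∩ [τ−h, τ)} φ) dτ`, both sides being
the integral of `φ(s) g(τ)` over the window `{0 < s ≤ T − h, s < τ ≤ s + h}`; and the inner
integral on the right, times `g`, is integrable in `τ`. [folklore] -/
theorem window_fubini {φ g : ℝ → ℝ} {T h M : ℝ} (hh : 0 < h)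
    (hφm : AEStronglyMeasurable φ (volume.restrict (Ioc 0 T)))
    (hφb : ∀ s ∈ Ioc 0 T, |φ s| ≤ M) (hg : IntegrableOn g (Ioc 0 T)) :
    Integrable (fun τ => g τ * ∫ s in Ioc 0 (T - h) ∩ Ico (τ - h) τ, φ s)
        (volume.restrict (Ioc 0 T)) ∧
      ∫ s in Ioc 0 (T - h), φ s * ∫ τ in Ioc s (s + h), g τ =
        ∫ τ in Ioc 0 T, g τ * ∫ s in Ioc 0 (T - h) ∩ Ico (τ - h) τ, φ s := by
  set μ : Measure ℝ := volume.restrict (Ioc 0 (T - h)) with hμ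
  set ν : Measure ℝ := volume.restrict (Ioc 0 T) with hν
  set K : Set (ℝ × ℝ) := {p : ℝ × ℝ | p.1 < p.2 ∧ p.2 ≤ p.1 + h} with hK
  set F : ℝ × ℝ → ℝ := K.indicator fun p => φ p.1 * g p.2 with hF
  have hsub : Ioc 0 (T - h) ⊆ Ioc 0 T := Ioc_subset_Ioc_right (by linarith)
  -- integrability on the product
  have hφμ : Integrable φ μ := by
    refine Integrable.of_bound (hφm.mono_measure (Measure.restrict_mono hsub le_rfl)) M ?_
    filter_upwards [ae_restrict_mem measurableSet_Ioc] with s hs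
    rw [Real.norm_eq_abs]
    exact hφb s (hsub hs)
  have hFi : Integrable F (μ.prod ν) := (hφμ.mul_prod hg).indicator (measurableSet_window h)
  -- the inner integral in `τ`
  have h1 : ∀ s ∈ Ioc 0 (T - h), ∫ τ, F (s, τ) ∂ν = φ s * ∫ τ in Ioc s (s + h), g τ := by
    intro s hs
    have hKs : ∀ τ, F (s, τ) = (Ioc s (s + h)).indicator (fun τ => φ s * g τ) τ := by
      intro τ
      by_cases hτ : τ ∈ Ioc s (s + h)
      · rw [indicator_of_mem hτ, hF, indicator_of_mem (show (s, τ) ∈ K from hτ)]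
      · rw [indicator_of_notMem hτ, hF, indicator_of_notMem (show (s, τ) ∉ K from hτ)]
    simp_rw [hKs]
    rw [integral_indicator measurableSet_Ioc, Measure.restrict_restrict measurableSet_Ioc,
      inter_eq_left.2 (Ioc_subset_Ioc hs.1.le (by linarith [hs.2])), integral_const_mul]
  -- the inner integral in `s`
  have h2 : ∀ τ, ∫ s, F (s, τ) ∂μ = g τ * ∫ s in Ioc 0 (T - h) ∩ Ico (τ - h) τ, φ s := by
    intro τ
    have hKτ : ∀ s, F (s, τ) = (Ico (τ - h) τ).indicator (fun s => φ s * g τ) s := by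
      intro s
      by_cases hs : s ∈ Ico (τ - h) τ
      · rw [indicator_of_mem hs, hF, indicator_of_mem]
        exact ⟨hs.2, by linarith [hs.1]⟩
      · rw [indicator_of_notMem hs, hF, indicator_of_notMem]
        intro hk
        exact hs ⟨by linarith [hk.2], hk.1⟩
    simp_rw [hKτ]
    rw [integral_indicator measurableSet_Ico, Measure.restrict_restrict measurableSet_Ico,
      integral_mul_const, mul_comm, inter_comm]
  refine ⟨?_, ?_⟩
  · refine hFi.integral_prod_right.congr ?_
    exact Eventually.of_forall fun τ => h2 τ
  · calc ∫ s in Ioc 0 (T - h), φ s * ∫ τ in Ioc s (s + h), g τ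
        = ∫ s, ∫ τ, F (s, τ) ∂ν ∂μ :=
          setIntegral_congr_fun measurableSet_Ioc fun s hs => (h1 s hs).symm
      _ = ∫ τ, ∫ s, F (s, τ) ∂μ ∂ν := integral_integral_swap (f := fun s τ => F (s, τ)) hFi
      _ = ∫ τ in Ioc 0 T, g τ * ∫ s in Ioc 0 (T - h) ∩ Ico (τ - h) τ, φ s :=
          integral_congr_ae (Eventually.of_forall fun τ => h2 τ)

/-- The window integral of a function bounded by `M` is bounded by `M h`. [folklore] -/
theorem abs_window_integral_le {φ : ℝ → ℝ} {T h M : ℝ} (hh : 0 ≤ h) (hφb : ∀ s, |φ s| ≤ M)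
    (τ : ℝ) : |∫ s in Ioc 0 (T - h) ∩ Ico (τ - h) τ, φ s| ≤ M * h := by
  have hvol : volume (Ioc 0 (T - h) ∩ Ico (τ - h) τ) < ∞ :=
    (measure_mono inter_subset_right).trans_lt measure_Ico_lt_top
  have hle := norm_setIntegral_le_of_norm_le_const hvol fun s _ =>
    (show ‖φ s‖ ≤ M by rw [Real.norm_eq_abs]; exact hφb s)
  have hM : 0 ≤ M := (abs_nonneg _).trans (hφb 0)
  have hreal : volume.real (Ioc 0 (T - h) ∩ Ico (τ - h) τ) ≤ h :=
    calc volume.real (Ioc 0 (T - h) ∩ Ico (τ - h) τ) ≤ volume.real (Ico (τ - h) τ) :=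
          measureReal_mono inter_subset_right measure_Ico_lt_top.ne
      _ = h := by rw [Real.volume_real_Ico_of_le (by linarith)]; ring
  rw [Real.norm_eq_abs] at hle
  exact hle.trans (by gcongr)

/-! ### Lebesgue differentiation of the window averages -/

/-- **Left window averages converge a.e.** (Lebesgue's differentiation theorem): for `φ`
bounded continuous and `y` measurable on `(0, T]`, for a.e. `τ ∈ (0, T]`,
`h⁻¹ ∫_{(0,T−h] ∩ [τ−h, τ)} φ∘y → φ(y(τ))` as `h → 0⁺`. [folklore] -/
theorem ae_tendsto_window_average {y φ : ℝ → ℝ} {T M : ℝ} (hφc : Continuous φ)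
    (hφb : ∀ x, |φ x| ≤ M) (hym : AEStronglyMeasurable y (volume.restrict (Ioc 0 T))) :
    ∀ᵐ τ ∂(volume.restrict (Ioc 0 T)), Tendsto
      (fun h : ℝ => h⁻¹ * ∫ s in Ioc 0 (T - h) ∩ Ico (τ - h) τ, φ (y s)) (𝓝[>] 0)
      (𝓝 (φ (y τ))) := by
  set Φ : ℝ → ℝ := (Ioc 0 T).indicator fun s => φ (y s) with hΦ
  have hφym : AEStronglyMeasurable (fun s => φ (y s)) (volume.restrict (Ioc 0 T)) :=
    hφc.comp_aestronglyMeasurable hym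
  have hΦi : Integrable Φ volume := by
    rw [hΦ, integrable_indicator_iff measurableSet_Ioc]
    exact Integrable.of_bound hφym M (ae_of_all _ fun s => by
      rw [Real.norm_eq_abs]; exact hφb _)
  have hLD := LocallyIntegrable.ae_hasDerivAt_integral hΦi.locallyIntegrable
  have hT' : ∀ᵐ τ ∂(volume : Measure ℝ), τ ≠ T := by
    rw [ae_iff]
    simp
  filter_upwards [ae_restrict_of_ae hLD, ae_restrict_of_ae hT',
    ae_restrict_mem measurableSet_Ioc] with τ hτ hτT hτI
  have hτ0 : 0 < τ := hτI.1
  have hτT' : τ < T := lt_of_le_of_ne hτI.2 hτT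
  have hslope := (hτ 0).tendsto_slope_zero_left
  have hneg : Tendsto (fun h : ℝ => -h) (𝓝[>] (0 : ℝ)) (𝓝[<] 0) := by
    simpa using tendsto_neg_nhdsGT (a := (0 : ℝ))
  have h2 := hslope.comp hneg
  have hΦτ : Φ τ = φ (y τ) := by rw [hΦ, indicator_of_mem hτI]
  rw [hΦτ] at h2
  refine h2.congr' ?_
  have hm : 0 < min τ (T - τ) := lt_min hτ0 (by linarith)
  filter_upwards [Ioo_mem_nhdsGT hm] with h hh
  have hh0 : 0 < h := hh.1
  have hhτ : h < τ := hh.2.trans_le (min_le_left _ _)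
  have hhT : h < T - τ := hh.2.trans_le (min_le_right _ _)
  simp only [Function.comp_apply, smul_eq_mul]
  have hsub : (∫ t in (0 : ℝ)..τ, Φ t) - ∫ t in (0 : ℝ)..(τ + -h), Φ t =
      ∫ t in (τ + -h)..τ, Φ t :=
    intervalIntegral.integral_interval_sub_left hΦi.intervalIntegrable hΦi.intervalIntegrable
  have hset : Ioc 0 (T - h) ∩ Ico (τ - h) τ = Ico (τ - h) τ :=
    inter_eq_right.2 fun s hs => ⟨by linarith [hs.1], by linarith [hs.2]⟩
  have hint : ∫ t in (τ + -h)..τ, Φ t = ∫ s in Ioc 0 (T - h) ∩ Ico (τ - h) τ, φ (y s) := by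
    rw [intervalIntegral.integral_of_le (by linarith), hset,
      setIntegral_congr_set (Ico_ae_eq_Ioc (μ := (volume : Measure ℝ))),
      show τ + -h = τ - h by ring]
    refine setIntegral_congr_fun measurableSet_Ioc fun s hs => ?_
    rw [hΦ, indicator_of_mem]
    exact ⟨by linarith [hs.1], by linarith [hs.2]⟩
  rw [← hint, ← hsub, inv_neg, neg_mul, ← mul_neg, neg_sub]

/-- **Dominated convergence for the window averages**: for `g ∈ L¹(0, T)`,
`∫₀ᵀ g(τ) h⁻¹ (∫_{(0,T−h] ∩ [τ−h, τ)} φ∘y) dτ → ∫₀ᵀ g φ∘y` as `h → 0⁺` (the averages are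
bounded by `M` and converge a.e., `ae_tendsto_window_average`). [folklore] -/
theorem tendsto_window_integral {y g φ : ℝ → ℝ} {T M : ℝ} (hT : 0 < T) (hφc : Continuous φ)
    (hφb : ∀ x, |φ x| ≤ M) (hym : AEStronglyMeasurable y (volume.restrict (Ioc 0 T)))
    (hg : IntegrableOn g (Ioc 0 T)) :
    Tendsto (fun h : ℝ => ∫ τ in Ioc 0 T,
        g τ * (h⁻¹ * ∫ s in Ioc 0 (T - h) ∩ Ico (τ - h) τ, φ (y s)))
      (𝓝[>] 0) (𝓝 (∫ τ in Ioc 0 T, g τ * φ (y τ))) := by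
  have hM0 : 0 ≤ M := (abs_nonneg _).trans (hφb 0)
  have hone : IntegrableOn (fun _ : ℝ => (1 : ℝ)) (Ioc 0 T) :=
    integrableOn_const (hs := measure_Ioc_lt_top.ne)
  refine tendsto_integral_filter_of_dominated_convergence (fun τ => M * ‖g τ‖) ?_ ?_
    (hg.norm.const_mul M) ?_
  · filter_upwards [Ioo_mem_nhdsGT hT] with h hh
    have hW := (window_fubini hh.1 (hφc.comp_aestronglyMeasurable hym)
      (fun s _ => hφb (y s)) hone).1
    have hWm : AEStronglyMeasurable
        (fun τ => ∫ s in Ioc 0 (T - h) ∩ Ico (τ - h) τ, φ (y s))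
        (volume.restrict (Ioc 0 T)) := by
      simpa only [one_mul] using hW.aestronglyMeasurable
    exact hg.aestronglyMeasurable.mul (hWm.const_mul h⁻¹)
  · filter_upwards [self_mem_nhdsWithin] with h hh
    have hh0 : 0 < h := hh
    refine ae_of_all _ fun τ => ?_
    rw [norm_mul, mul_comm]
    refine mul_le_mul_of_nonneg_right ?_ (norm_nonneg _)
    rw [Real.norm_eq_abs, abs_mul, abs_inv, abs_of_pos hh0]
    have hle := abs_window_integral_le (T := T) hh0.le (fun s => hφb (y s)) τ
    calc h⁻¹ * |∫ s in Ioc 0 (T - h) ∩ Ico (τ - h) τ, φ (y s)| ≤ h⁻¹ * (M * h) := by gcongr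
      _ = M := by field_simp
  · exact (ae_tendsto_window_average hφc hφb hym).mono fun τ hτ => hτ.const_mul (g τ)

/-! ### The key inequality at a fixed step `h` -/

/-- **The telescoped Steklov inequality at step `h`.** Under the hypotheses of
`intervalIntegral_le_setIntegral_of_integrable`, for `0 < h < T` and `ηb` bounding `∫_J |g|`
over all subintervals `J ⊆ [0, T]` of length `≤ h`:
`P(y(T)) − P(E₀) ≤ h⁻¹ ∫₀ᵀ g(τ) (∫_{(0,T−h]∩[τ−h,τ)} φ∘y) dτ + 2M ηb + L ηb ∫₀ᵀ |g|`,
`P = ∫₀ φ`. [folklore] -/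
theorem key_ineq {y g φ : ℝ → ℝ} {T E₀ M R ηb h : ℝ} {L : ℝ≥0}
    (hφL : LipschitzWith L φ) (hφ0 : ∀ x, 0 ≤ φ x) (hφM : ∀ x, φ x ≤ M)
    (hym : AEStronglyMeasurable y (volume.restrict (Ioc 0 T)))
    (hyR : ∀ t ∈ Ioc 0 T, |y t| ≤ R) (hg : Integrable g)
    (h0 : ∀ t ∈ Ioc 0 T, y t ≤ E₀ + ∫ τ in Ioc 0 t, g τ)
    (hae : ∀ᵐ s, s ∈ Ioo 0 T → ∀ t ∈ Icc s T, y t ≤ y s + ∫ τ in Ioc s t, g τ)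
    (hh : 0 < h) (hhT : h < T)
    (hηb : ∀ a b, 0 ≤ a → b ≤ T → b - a ≤ h → ∫ τ in Ioc a b, |g τ| ≤ ηb) :
    (∫ x in (0 : ℝ)..y T, φ x) - ∫ x in (0 : ℝ)..E₀, φ x ≤
      h⁻¹ * (∫ τ in Ioc 0 T, g τ * ∫ s in Ioc 0 (T - h) ∩ Ico (τ - h) τ, φ (y s)) +
        2 * M * ηb + L * ηb * ∫ τ in Ioc 0 T, |g τ| := by
  -- constants and the primitive
  have hM0 : 0 ≤ M := (hφ0 0).trans (hφM 0)
  have hφc : Continuous φ := hφL.continuous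
  have hφi : ∀ a b, IntervalIntegrable φ volume a b := fun a b => hφc.intervalIntegrable a b
  have hφabs : ∀ x, |φ x| ≤ M := fun x => by rw [abs_of_nonneg (hφ0 x)]; exact hφM x
  set P : ℝ → ℝ := fun x => ∫ t in (0 : ℝ)..x, φ t with hP
  have hPsub : ∀ a b, P b - P a = ∫ t in a..b, φ t := fun a b =>
    intervalIntegral.integral_interval_sub_left (hφi 0 b) (hφi 0 a)
  have hPc : Continuous P := intervalIntegral.continuous_primitive hφi 0
  have hPmono : Monotone P := fun a b hab => by
    have h2 : 0 ≤ ∫ t in a..b, φ t := intervalIntegral.integral_nonneg hab fun x _ => hφ0 x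
    linarith [hPsub a b]
  have hPlip : ∀ a b, |P b - P a| ≤ M * |b - a| := fun a b => by
    rw [hPsub, ← Real.norm_eq_abs]
    exact intervalIntegral.norm_integral_le_of_norm_le_const fun x _ => by
      rw [Real.norm_eq_abs]; exact hφabs x
  have hTaylor : ∀ a G, P (a + G) - P a ≤ φ a * G + L * G ^ 2 := fun a G => by
    rw [hPsub]; exact primitive_taylor hφL a G
  have hP0 : P 0 = 0 := intervalIntegral.integral_same
  have hηb0 : 0 ≤ ηb := le_trans (setIntegral_nonneg measurableSet_Ioc fun τ _ => abs_nonneg _)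
    (hηb 0 0 le_rfl (hh.trans hhT).le (by linarith))
  change P (y T) - P E₀ ≤ _
  -- `P ∘ y` is integrable on `(0, T]`
  have hPym : AEStronglyMeasurable (fun t => P (y t)) (volume.restrict (Ioc 0 T)) :=
    hPc.comp_aestronglyMeasurable hym
  have hPyb : ∀ t ∈ Ioc 0 T, |P (y t)| ≤ M * R := fun t ht => by
    have := hPlip 0 (y t)
    rw [hP0, sub_zero, sub_zero] at this
    exact this.trans (mul_le_mul_of_nonneg_left (hyR t ht) hM0)
  have hPyi : IntegrableOn (fun t => P (y t)) (Ioc 0 T) := by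
    refine Integrable.of_bound hPym (M * R) ?_
    filter_upwards [ae_restrict_mem measurableSet_Ioc] with t ht
    rw [Real.norm_eq_abs]; exact hPyb t ht
  have hφym : AEStronglyMeasurable (fun t => φ (y t)) (volume.restrict (Ioc 0 T)) :=
    hφc.comp_aestronglyMeasurable hym
  -- the moduli: `G s = ∫_{(s, s+h]} g`, `Ga s = ∫_{(s, s+h]} |g|`
  have hgi : ∀ a b, IntervalIntegrable g volume a b := fun a b => hg.intervalIntegrable
  have hgai : ∀ a b, IntervalIntegrable (fun τ => |g τ|) volume a b := fun a b =>
    hg.abs.intervalIntegrable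
  set Ig : ℝ → ℝ := fun x => ∫ τ in (0 : ℝ)..x, g τ with hIg
  set Iga : ℝ → ℝ := fun x => ∫ τ in (0 : ℝ)..x, |g τ| with hIga
  have hIgc : Continuous Ig := intervalIntegral.continuous_primitive hgi 0
  have hIgac : Continuous Iga := intervalIntegral.continuous_primitive hgai 0
  have hG : ∀ s, ∫ τ in Ioc s (s + h), g τ = Ig (s + h) - Ig s := fun s => by
    rw [hIg]; dsimp only
    rw [intervalIntegral.integral_interval_sub_left (hgi 0 (s + h)) (hgi 0 s),
      intervalIntegral.integral_of_le (by linarith)]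
  have hGa : ∀ s, ∫ τ in Ioc s (s + h), |g τ| = Iga (s + h) - Iga s := fun s => by
    rw [hIga]; dsimp only
    rw [intervalIntegral.integral_interval_sub_left (hgai 0 (s + h)) (hgai 0 s),
      intervalIntegral.integral_of_le (by linarith)]
  have hGc : Continuous fun s => ∫ τ in Ioc s (s + h), g τ := by
    simp_rw [hG]; exact (hIgc.comp (continuous_id.add continuous_const)).sub hIgc
  have hGac : Continuous fun s => ∫ τ in Ioc s (s + h), |g τ| := by
    simp_rw [hGa]; exact (hIgac.comp (continuous_id.add continuous_const)).sub hIgac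
  have hGabs : ∀ s, |∫ τ in Ioc s (s + h), g τ| ≤ ∫ τ in Ioc s (s + h), |g τ| := fun s => by
    rw [← Real.norm_eq_abs]
    exact (norm_integral_le_integral_norm _).trans_eq rfl
  have hGa_le : ∀ s, 0 ≤ s → s + h ≤ T → ∫ τ in Ioc s (s + h), |g τ| ≤ ηb := fun s hs hsT =>
    hηb s (s + h) hs hsT (by linarith)
  -- (1) boundary at `0`: `∫_{(0,h]} P∘y ≤ h (P E₀ + M ηb)`
  have hB0 : ∫ s in Ioc 0 h, P (y s) ≤ h * (P E₀ + M * ηb) := by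
    have hconst : ∫ s in Ioc 0 h, (P E₀ + M * ηb) = h * (P E₀ + M * ηb) := by
      rw [setIntegral_const, Real.volume_real_Ioc_of_le hh.le, sub_zero, smul_eq_mul]
    rw [← hconst]
    refine setIntegral_mono_on (hPyi.mono_set (Ioc_subset_Ioc_right hhT.le))
      (integrableOn_const (hs := measure_Ioc_lt_top.ne)) measurableSet_Ioc fun s hs => ?_
    have hsT : s ∈ Ioc 0 T := ⟨hs.1, hs.2.trans hhT.le⟩
    have hgs : IntegrableOn g (Ioc 0 s) := hg.integrableOn
    have h1 : ∫ τ in Ioc 0 s, g τ ≤ ηb :=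
      calc ∫ τ in Ioc 0 s, g τ ≤ ∫ τ in Ioc 0 s, |g τ| :=
            integral_mono hgs hgs.abs fun τ => le_abs_self _
        _ ≤ ηb := hηb 0 s le_rfl hsT.2 (by linarith [hs.2])
    have h2 : y s ≤ E₀ + ηb := (h0 s hsT).trans (by linarith)
    have h3 : P (E₀ + ηb) - P E₀ ≤ M * ηb := by
      have := hPlip E₀ (E₀ + ηb)
      rw [add_sub_cancel_left, abs_of_nonneg hηb0] at this
      exact (le_abs_self _).trans this
    linarith [hPmono h2]
  -- (2) boundary at `T`: `h (P (y T) - M ηb) ≤ ∫_{(T-h,T]} P∘y`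
  have hBT : h * (P (y T) - M * ηb) ≤ ∫ s in Ioc (T - h) T, P (y s) := by
    have hconst : ∫ s in Ioc (T - h) T, (P (y T) - M * ηb) = h * (P (y T) - M * ηb) := by
      rw [setIntegral_const, Real.volume_real_Ioc_of_le (by linarith), smul_eq_mul]
      ring
    rw [← hconst]
    refine setIntegral_mono_ae_restrict (integrableOn_const (hs := measure_Ioc_lt_top.ne))
      (hPyi.mono_set (Ioc_subset_Ioc_left (by linarith))) ?_
    filter_upwards [ae_restrict_of_ae hae, ae_restrict_mem measurableSet_Ioc] with s hs hsI
    rcases eq_or_lt_of_le hsI.2 with rfl | hsT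
    · linarith [mul_nonneg hM0 hηb0]
    · have hs0 : 0 < s := by linarith [hsI.1]
      have h1 := hs ⟨hs0, hsT⟩ T ⟨hsT.le, le_rfl⟩
      have h2 : ∫ τ in Ioc s T, g τ ≤ ηb :=
        calc ∫ τ in Ioc s T, g τ ≤ ∫ τ in Ioc s T, |g τ| :=
              integral_mono hg.integrableOn hg.integrableOn.abs fun τ => le_abs_self _
          _ ≤ ηb := hηb s T hs0.le le_rfl (by linarith [hsI.1])
      have h3 : P (y T) - P (y T - ηb) ≤ M * ηb := by
        have := hPlip (y T - ηb) (y T)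
        rw [sub_sub_cancel, abs_of_nonneg hηb0] at this
        exact (le_abs_self _).trans this
      have h4 : P (y T - ηb) ≤ P (y s) := hPmono (by linarith)
      linarith
  -- (3) interior: the pointwise Steklov inequality for a.e. `s ∈ (0, T - h]`
  have hpt : ∀ᵐ s ∂(volume.restrict (Ioc 0 (T - h))),
      P (y (s + h)) - P (y s) ≤
        φ (y s) * (∫ τ in Ioc s (s + h), g τ) + L * ηb * ∫ τ in Ioc s (s + h), |g τ| := by
    filter_upwards [ae_restrict_of_ae hae, ae_restrict_mem measurableSet_Ioc] with s hs hsI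
    have hs0 : 0 < s := hsI.1
    have hsT : s + h ≤ T := by linarith [hsI.2]
    have h1 := hs ⟨hs0, by linarith⟩ (s + h) ⟨by linarith, hsT⟩
    set G := ∫ τ in Ioc s (s + h), g τ with hGdef
    have h2 : P (y (s + h)) ≤ P (y s + G) := hPmono h1
    have h3 := hTaylor (y s) G
    have hGa := hGa_le s hs0.le hsT
    have h4 : G ^ 2 ≤ ηb * ∫ τ in Ioc s (s + h), |g τ| := by
      rw [sq, ← abs_mul_abs_self]
      exact mul_le_mul ((hGabs s).trans hGa) (hGabs s) (abs_nonneg _) hηb0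
    have h5 : (L : ℝ) * G ^ 2 ≤ L * ηb * ∫ τ in Ioc s (s + h), |g τ| := by
      rw [mul_assoc]; exact mul_le_mul_of_nonneg_left h4 L.2
    linarith
  -- integrate (3) over `(0, T - h]`
  have hmp : MeasurePreserving (fun s : ℝ => s + h) volume volume := measurePreserving_add_right _ h
  have hme : MeasurableEmbedding (fun s : ℝ => s + h) := measurableEmbedding_addRight h
  have hpre : (fun s : ℝ => s + h) ⁻¹' Ioc h T = Ioc 0 (T - h) := by
    rw [preimage_add_const_Ioc, sub_self]
  have hshift_int : IntegrableOn (fun s => P (y (s + h))) (Ioc 0 (T - h)) := by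
    have := (hmp.integrableOn_comp_preimage hme (f := fun t => P (y t)) (s := Ioc h T)).2
      (hPyi.mono_set (Ioc_subset_Ioc_left hh.le))
    rwa [hpre] at this
  have hshift_eq : ∫ s in Ioc 0 (T - h), P (y (s + h)) = ∫ s in Ioc h T, P (y s) := by
    rw [← hpre]
    exact hmp.setIntegral_preimage_emb hme (fun t => P (y t)) (Ioc h T)
  have hsubT : Ioc 0 (T - h) ⊆ Ioc 0 T := Ioc_subset_Ioc_right (by linarith)
  have hφyG_int : IntegrableOn (fun s => φ (y s) * ∫ τ in Ioc s (s + h), g τ) (Ioc 0 (T - h)) := by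
    refine Integrable.of_bound ((hφym.mono_measure (Measure.restrict_mono hsubT le_rfl)).mul
      hGc.aestronglyMeasurable) (M * ηb) ?_
    filter_upwards [ae_restrict_mem measurableSet_Ioc] with s hs
    rw [norm_mul, Real.norm_eq_abs, Real.norm_eq_abs]
    exact mul_le_mul (hφabs _) ((hGabs s).trans (hGa_le s hs.1.le (by linarith [hs.2])))
      (abs_nonneg _) hM0
  have hGa_int : IntegrableOn (fun s => ∫ τ in Ioc s (s + h), |g τ|) (Ioc 0 (T - h)) :=
    hGac.integrableOn_Ioc
  have hInt3 : (∫ s in Ioc h T, P (y s)) - ∫ s in Ioc 0 (T - h), P (y s) ≤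
      (∫ s in Ioc 0 (T - h), φ (y s) * ∫ τ in Ioc s (s + h), g τ) +
        L * ηb * ∫ s in Ioc 0 (T - h), ∫ τ in Ioc s (s + h), |g τ| := by
    rw [← hshift_eq, ← integral_sub hshift_int (hPyi.mono_set hsubT), ← integral_const_mul,
      ← integral_add hφyG_int (hGa_int.const_mul _)]
    exact setIntegral_mono_ae_restrict (hshift_int.sub (hPyi.mono_set hsubT))
      (hφyG_int.add (hGa_int.const_mul _)) hpt
  -- Fubini on both window terms
  have hF1 := (window_fubini hh hφym (fun s _ => hφabs (y s)) hg.integrableOn).2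
  have hF2 := window_fubini (T := T) hh (aestronglyMeasurable_const (b := (1 : ℝ)))
    (fun s _ => (abs_one.le : |(1 : ℝ)| ≤ 1)) hg.abs.integrableOn
  have hGa_total : ∫ s in Ioc 0 (T - h), ∫ τ in Ioc s (s + h), |g τ| ≤
      h * ∫ τ in Ioc 0 T, |g τ| := by
    have h1 : ∫ s in Ioc 0 (T - h), ∫ τ in Ioc s (s + h), |g τ| =
        ∫ τ in Ioc 0 T, |g τ| * ∫ s in Ioc 0 (T - h) ∩ Ico (τ - h) τ, (1 : ℝ) := by
      have := hF2.2
      simp only [one_mul] at this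
      exact this
    rw [h1, ← integral_const_mul]
    refine integral_mono hF2.1 (hg.abs.integrableOn.const_mul h) fun τ => ?_
    dsimp only
    rw [mul_comm h]
    refine mul_le_mul_of_nonneg_left ?_ (abs_nonneg _)
    have := abs_window_integral_le (T := T) hh.le (fun _ => (abs_one.le : |(1 : ℝ)| ≤ 1)) τ
    rw [one_mul] at this
    exact (le_abs_self _).trans this
  -- (4) splitting `(0, T]` at `h` and at `T - h`
  have hsplit : (∫ s in Ioc h T, P (y s)) - ∫ s in Ioc 0 (T - h), P (y s) =
      (∫ s in Ioc (T - h) T, P (y s)) - ∫ s in Ioc 0 h, P (y s) := by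
    have e1 : ∫ s in Ioc 0 T, P (y s) = (∫ s in Ioc 0 h, P (y s)) + ∫ s in Ioc h T, P (y s) := by
      rw [← Ioc_union_Ioc_eq_Ioc hh.le hhT.le, setIntegral_union (Ioc_disjoint_Ioc_of_le le_rfl)
        measurableSet_Ioc (hPyi.mono_set (Ioc_subset_Ioc_right hhT.le))
        (hPyi.mono_set (Ioc_subset_Ioc_left hh.le))]
    have e2 : ∫ s in Ioc 0 T, P (y s) =
        (∫ s in Ioc 0 (T - h), P (y s)) + ∫ s in Ioc (T - h) T, P (y s) := by
      rw [← Ioc_union_Ioc_eq_Ioc (by linarith : (0 : ℝ) ≤ T - h) (by linarith : T - h ≤ T),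
        setIntegral_union (Ioc_disjoint_Ioc_of_le le_rfl) measurableSet_Ioc
        (hPyi.mono_set hsubT) (hPyi.mono_set (Ioc_subset_Ioc_left (by linarith)))]
    linarith
  -- assemble and divide by `h`
  have hN : 0 ≤ ∫ τ in Ioc 0 T, |g τ| := setIntegral_nonneg measurableSet_Ioc fun τ _ => abs_nonneg _
  have hmain : h * (P (y T) - P E₀) ≤
      (∫ τ in Ioc 0 T, g τ * ∫ s in Ioc 0 (T - h) ∩ Ico (τ - h) τ, φ (y s)) +
        h * (2 * M * ηb) + h * (L * ηb * ∫ τ in Ioc 0 T, |g τ|) := by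
    have hL0 : 0 ≤ (L : ℝ) * ηb := mul_nonneg L.2 hηb0
    nlinarith [hB0, hBT, hInt3, hsplit, hF1, hGa_total, mul_le_mul_of_nonneg_left hGa_total hL0]
  have hh' : h ≠ 0 := hh.ne'
  calc P (y T) - P E₀ = h⁻¹ * (h * (P (y T) - P E₀)) := by
        rw [← mul_assoc, inv_mul_cancel₀ hh', one_mul]
    _ ≤ h⁻¹ * ((∫ τ in Ioc 0 T, g τ * ∫ s in Ioc 0 (T - h) ∩ Ico (τ - h) τ, φ (y s)) +
        h * (2 * M * ηb) + h * (L * ηb * ∫ τ in Ioc 0 T, |g τ|)) :=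
        mul_le_mul_of_nonneg_left hmain (inv_nonneg.2 hh.le)
    _ = _ := by
        rw [mul_add, mul_add, ← mul_assoc h⁻¹ h, ← mul_assoc h⁻¹ h, inv_mul_cancel₀ hh',
          one_mul, one_mul]

/-! ### The chain-rule inequality -/

/-- **Chain-rule inequality for a restarted integral inequality** (global-`g` form). Let
`φ ≥ 0` be bounded and Lipschitz, `y` measurable and bounded on `(0, T]`, `g ∈ L¹(ℝ)`, and
suppose `y(t) ≤ E₀ + ∫_{(0,t]} g` for `t ∈ (0, T]` and, for a.e. `s ∈ (0, T)`,
`y(t) ≤ y(s) + ∫_{(s,t]} g` for all `t ∈ [s, T]`. Then `∫_{E₀}^{y(T)} φ ≤ ∫_{(0,T]} φ(y) g`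
(the generalized energy inequality of FMRT 2001, App. B.2 (B.33)–(B.36), proved by Steklov
averaging and Lebesgue differentiation instead of partitions). [cite: FMRT2001, App. B.2 (B.33)–(B.36)] -/
theorem intervalIntegral_le_setIntegral_of_integrable {y g φ : ℝ → ℝ} {T E₀ M R : ℝ} {L : ℝ≥0}
    (hT : 0 < T) (hφL : LipschitzWith L φ) (hφ0 : ∀ x, 0 ≤ φ x) (hφM : ∀ x, φ x ≤ M)
    (hym : AEStronglyMeasurable y (volume.restrict (Ioc 0 T)))
    (hyR : ∀ t ∈ Ioc 0 T, |y t| ≤ R) (hg : Integrable g)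
    (h0 : ∀ t ∈ Ioc 0 T, y t ≤ E₀ + ∫ τ in Ioc 0 t, g τ)
    (hae : ∀ᵐ s, s ∈ Ioo 0 T → ∀ t ∈ Icc s T, y t ≤ y s + ∫ τ in Ioc s t, g τ) :
    ∫ x in E₀..y T, φ x ≤ ∫ t in Ioc 0 T, φ (y t) * g t := by
  have hM0 : 0 ≤ M := (hφ0 0).trans (hφM 0)
  have hφc : Continuous φ := hφL.continuous
  have hφabs : ∀ x, |φ x| ≤ M := fun x => by rw [abs_of_nonneg (hφ0 x)]; exact hφM x
  have hφi : ∀ a b, IntervalIntegrable φ volume a b := fun a b => hφc.intervalIntegrable a b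
  rw [← intervalIntegral.integral_interval_sub_left (hφi 0 _) (hφi 0 E₀)]
  set N₁ : ℝ := ∫ τ in Ioc 0 T, |g τ| with hN₁
  have hN₁0 : 0 ≤ N₁ := setIntegral_nonneg measurableSet_Ioc fun τ _ => abs_nonneg _
  set I : ℝ := ∫ τ in Ioc 0 T, g τ * φ (y τ) with hI
  have hIeq : ∫ t in Ioc 0 T, φ (y t) * g t = I := by
    rw [hI]; exact integral_congr_ae (ae_of_all _ fun t => mul_comm _ _)
  rw [hIeq]
  refine le_of_forall_pos_le_add fun ε hε => ?_
  -- the small parameter `ηb`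
  obtain ⟨ηb, hηb0, hηbε⟩ : ∃ ηb : ℝ, 0 < ηb ∧ 2 * M * ηb + L * ηb * N₁ ≤ ε / 2 := by
    refine ⟨ε / 2 / (2 * M + L * N₁ + 1), by positivity, ?_⟩
    have hD : 0 < 2 * M + L * N₁ + 1 := by positivity
    rw [show 2 * M * (ε / 2 / (2 * M + L * N₁ + 1)) + L * (ε / 2 / (2 * M + L * N₁ + 1)) * N₁ =
      ε / 2 * ((2 * M + L * N₁) / (2 * M + L * N₁ + 1)) by field_simp]
    have : (2 * M + ↑L * N₁) / (2 * M + ↑L * N₁ + 1) ≤ 1 := by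
      rw [div_le_one hD]; linarith
    calc ε / 2 * ((2 * M + ↑L * N₁) / (2 * M + ↑L * N₁ + 1)) ≤ ε / 2 * 1 := by gcongr
      _ = ε / 2 := mul_one _
  obtain ⟨δ, hδ0, hδ⟩ := exists_forall_setIntegral_abs_le hg.integrableOn hηb0
  -- the limit of the window term
  have hA := tendsto_window_integral hT hφc hφabs hym hg.integrableOn
  have hA' : ∀ᶠ h in 𝓝[>] (0 : ℝ), h⁻¹ * (∫ τ in Ioc 0 T,
      g τ * ∫ s in Ioc 0 (T - h) ∩ Ico (τ - h) τ, φ (y s)) ≤ I + ε / 2 := by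
    have hev := (hA.eventually (Iio_mem_nhds (show I < I + ε / 2 by linarith)))
    filter_upwards [hev] with h hh
    rw [← integral_const_mul]
    refine le_of_lt (lt_of_eq_of_lt (integral_congr_ae (ae_of_all _ fun τ => ?_)) hh)
    ring
  have hT' : ∀ᶠ h in 𝓝[>] (0 : ℝ), h ∈ Ioo 0 T := Ioo_mem_nhdsGT hT
  have hδ' : ∀ᶠ h in 𝓝[>] (0 : ℝ), h ∈ Ioc 0 δ := Ioc_mem_nhdsGT hδ0
  obtain ⟨h, hhA, hhT, hhδ⟩ := (hA'.and (hT'.and hδ')).exists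
  have hK := key_ineq hφL hφ0 hφM hym hyR hg h0 hae hhT.1 hhT.2
    (fun a b ha hb hab => hδ a b ha hb (hab.trans hhδ.2))
  linarith

/-- **Chain-rule inequality for a restarted integral inequality.** Let `φ ≥ 0` be bounded and
Lipschitz, `y` measurable and bounded on `(0, T]`, `g ∈ L¹(0, T)`, with
`y(t) ≤ E₀ + ∫_{(0,t]} g` for `t ∈ (0, T]` (the energy inequality from `s = 0`) and, for a.e.
`s ∈ (0, T)`, `y(t) ≤ y(s) + ∫_{(s,t]} g` for all `t ∈ [s, T]` (the energy inequality from
a.e. `s`). Then `∫_{E₀}^{y(T)} φ ≤ ∫_{(0,T]} φ(y(t)) g(t) dt` — the generalized energy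
inequality (B.33)–(B.36) of FMRT 2001, App. B.2, `ρ = ∫ φ`, obtained by Steklov averaging,
absolute continuity of the integral and Lebesgue's differentiation theorem. [cite: FMRT2001, App. B.2 (B.33)–(B.36)] -/
theorem intervalIntegral_le_setIntegral {y g φ : ℝ → ℝ} {T E₀ M R : ℝ} {L : ℝ≥0}
    (hT : 0 < T) (hφL : LipschitzWith L φ) (hφ0 : ∀ x, 0 ≤ φ x) (hφM : ∀ x, φ x ≤ M)
    (hym : AEStronglyMeasurable y (volume.restrict (Ioc 0 T)))
    (hyR : ∀ t ∈ Ioc 0 T, |y t| ≤ R) (hg : IntegrableOn g (Ioc 0 T))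
    (h0 : ∀ t ∈ Ioc 0 T, y t ≤ E₀ + ∫ τ in Ioc 0 t, g τ)
    (hae : ∀ᵐ s, s ∈ Ioo 0 T → ∀ t ∈ Icc s T, y t ≤ y s + ∫ τ in Ioc s t, g τ) :
    ∫ x in E₀..y T, φ x ≤ ∫ t in Ioc 0 T, φ (y t) * g t := by
  set g₀ : ℝ → ℝ := (Ioc 0 T).indicator g with hg₀
  have hg₀i : Integrable g₀ := (integrable_indicator_iff measurableSet_Ioc).2 hg
  have heq : ∀ s t, 0 ≤ s → t ≤ T → ∫ τ in Ioc s t, g₀ τ = ∫ τ in Ioc s t, g τ :=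
    fun s t hs ht => setIntegral_congr_fun measurableSet_Ioc fun τ hτ => by
      rw [hg₀, indicator_of_mem (show τ ∈ Ioc 0 T from ⟨hs.trans_lt hτ.1, hτ.2.trans ht⟩)]
  have h0' : ∀ t ∈ Ioc 0 T, y t ≤ E₀ + ∫ τ in Ioc 0 t, g₀ τ := fun t ht => by
    rw [heq 0 t le_rfl ht.2]; exact h0 t ht
  have hae' : ∀ᵐ s, s ∈ Ioo 0 T → ∀ t ∈ Icc s T, y t ≤ y s + ∫ τ in Ioc s t, g₀ τ := by
    filter_upwards [hae] with s hs hsI t ht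
    rw [heq s t hsI.1.le ht.2]; exact hs hsI t ht
  have := intervalIntegral_le_setIntegral_of_integrable hT hφL hφ0 hφM hym hyR hg₀i h0' hae'
  refine this.trans_eq (setIntegral_congr_fun measurableSet_Ioc fun t ht => ?_)
  rw [hg₀, indicator_of_mem ht]

end RestartedChainRule

end Literature.Analysis.FluidPDE
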